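import Summits.QuantumFields.YangMills.Theorems.BalabanUVNodesN15AtReadingOfRecord13CoPH
import Summits.QuantumFields.YangMills.Theorems.BalabanUVNodesN15FullPropagatorCov2156N15At

/-!
# Route «BalabanUVNodes», cluster K4 «SpineRates» — node N15 = NE2: THE WINDOW-FREE GENUINE `U ≡ 1` FAMILY (unit layer := [B6] (2.156) `C^{(k)}_Λ`, part 76) AT BOTH
# STAGE-13 v1.7 `CoPH` HOMES AND AT THE READING OF RECORD — the producer faces for n27-c's `h15` WITHOUT the weight window

Cell `pub-ymgap`, seat `pub-ymgap-dag-n15-a` (-a KNIT-BY-NAME seat of node N15; HUMAN RULING D-0062; chair R424 venue), generation 15, part 77 (THEOREMS ONLY, 0 `def`,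
0 `sorry`).  `bears_on: R4∕N15 · K3⁷ SpineGivenEndpointR13SepCoPH (stmt-QuantumFields-20544; dag-lead WORDS-143)`.  Filed `--kind proof --supports stmt-QuantumFields-20544
--as helper` — COUNT-NEUTRAL.  Imports part 75 `…N15AtReadingOfRecord13CoPH` (the faces at `RRec₁₃CoPH` ∕ `RRec₁₃CoPHOn` ∕ `readingOfRecord₁₃CoPH w1 ℓ₃ ne2 ne1`, dag-n22-e
1″∕5″∕6″ᶜᵒᵖᴴ) and part 76 `…N15FullPropagatorCov2156N15At` (`fullGCovObjects`, `n15At_fullGCovObjects`, `s_N15_of_admits_fullGCov_family`, `populated_fullGCovObjects_family`);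
nothing in the tree is modified.

WHY.  Part 75 §3 gave the producer faces of the GENUINE `U ≡ 1` family `fullGObjects` at the v1.7 `CoPH` homes, each under part 73's weight window
`∃ a₀ : T4Family → ℝ, (∀ F, 0 < a₀ F) ∧ ∀ a, (∀ F, a F ≠ 0 ∧ |a F| ≤ a₀ F) → …` (the Neumann window of the King-form unit kernel); dag-n27-c's leaf
`…N27AtAdmReadingOfRecord13CoPHKnitN15.spine_rec13CCoPH_at_readingAdm₁₃CoPH_of_fullG_family` (p551502) displays that prefix.  Part 76 replaced the third layer by Bałaban's
own (2.156) covariance (`T4Cov2156Rate`, positivity mechanism) and proved `N15At` for `fullGCovObjects 3 F.hL b a_S ν μ α β c₃₅ p` OUTRIGHT.  This file is part 75 §3 for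
that family with the window GONE — every face a plain implication «residual layer = the genuine objects ⟹ `S_N15` at the home(s)», every existence face hypothesis-free:
`s_N15_rRec₁₃CoPH_of_fullGCovReading`, `s_N15_rRec₁₃CoPHOn_of_fullGCovReading`, ★★ `exists_reading_s_N15_rRec₁₃CoPH_fullGCov_family`,
★★ `s_N15_readingOfRecord₁₃CoPH_homes_of_fullGCov_family` (the by-name swap for n27-c's §1∕§2: same hypothesis shape as part 75's `…_homes_of_fullG_family` minus the
window, conclusion both homes), `s_N15_readingOfRecord₁₃CoPH_of_fullGCov_family`, `s_N15_readingOfRecord₁₃CoPHOn_of_fullGCov_family`,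
`populated_readingOfRecord₁₃CoPH_of_fullGCov_family`, ★★ `exists_ne2_s_N15_readingOfRecord₁₃CoPH_fullGCov`.

HONEST FRAMING.  Count-neutral kernel bookkeeping BY NAME; no estimate here (the estimates are parts 52∕54∕59∕71∕72, dag-n15-c G1, `T4Cov2156Rate.cov2156_rate_torus_king`).
The family is the `U ≡ 1` (A = 0) content of node N15 on the L-divisible tori of each datum family (`M_μ = 2·F.L^{m_T}`, `m_T ≥ 1`): one-point background carrier (the «+»
blocks inert), inert [B9] size parameter; NOT Bałaban's multiscale `G(U)` ∕ `C^{(k)}(Λ)(U)` with the background LIVE (NE2⁺ proper — NOT PRINTED), NOT Node 00's [B9] operator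
layer of record (residual) — **N15 is NOT discharged** (typed 28∕28 · discharged 5∕27 of record unchanged); the readings `𝔯`, towers `w1`, letters `ℓ₃`, NODE O's `ne1` are
PARAMETERS; one finite four-torus programme at fixed `ε` — NOT ℝ⁴, NOT infinite volume, NOT OS, NOT a mass gap, NOT Clay.  Restate-immune (no Theses import).
-/

set_option autoImplicit false

noncomputable section
namespace Summit.QuantumFields.YangMills.BalabanUVNodes.N15.AtReadingOfRecord13CoPH

open Literature.MathematicalPhysics.QuantumFieldTheory.Balaban1983to89
open Literature.MathematicalPhysics.QuantumFieldTheory.Balaban1983to89.T4Continuum (T4Family ULoop)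
open Node00 (IsDatumOfRecord₁₃CCoPH Stage13HParams NE2Objects₁₁ NE3Letters₁₁)
open Node00.W1 (ReadingData)
open Summit.QuantumFields.BalabanUV.T4Continuum.HistoryFlow (two_le_L)
open Summit.QuantumFields.YangMills.BalabanUVNodes.N15.AtKeyedHome (neZero_blockFactor)
open Summit.QuantumFields.YangMills.BalabanUVNodes.N15.AtRRec13CoPH (admits_rRec₁₃CoPH_ne2 s_N15_rRec₁₃CoPHOn_of_pin s_N15_homes₁₃CoPH_of_forall_admissible)
open Summit.QuantumFields.YangMills.BalabanUVNodes.N15.GenuineRecord (fullGCovObjects n15At_fullGCovObjects s_N15_of_admits_fullGCov_family populated_fullGCovObjects_family)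
open YMDAG.UVSplit (Datum NE1pCarriers RateCarriers RateRecordPred N15At S_N15 ne2OfRecord₁₁ RateReading₁₃CoPH RRec₁₃CoPH RRec₁₃CoPHOn readingOfRecord₁₃CoPH
  readingOfRecord₁₃CoPH_populated_iff)

variable {N : ℕ} [NeZero N]

/-! ## §1 The window-free genuine reading at both CoPH homes -/

section Genuine

variable {b aS : ℝ}

/-- `N15At` at the window-free genuine literal of a datum family (part 76 `n15At_fullGCovObjects` at `(3, F.hL)`; `2 ≤ F.L` from `11 < L`). [bookkeeping] -/
theorem n15At_fullGCovObjects_family (hb : 0 < b) (haS : 0 < aS) (ν μ α β : Fin 4) (c35 p : ℝ) (F : T4Family) :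
    N15At (ne2OfRecord₁₁ (haveI := neZero_blockFactor F; fullGCovObjects 3 F.hL b aS ν μ α β c35 p)) := by
  haveI := neZero_blockFactor F
  exact n15At_fullGCovObjects (d := 3) (by norm_num) F.hL.1 (two_le_L F) F.hL hb haS ν μ α β c35 p

/-- ★ **THE WINDOW-FREE GENUINE READING CLOSES THE STUB AT THE CANONICAL HOME, NO ESTIMATE AND NO WEIGHT DISPLAYED.**  For `b, a_S > 0`, directions `ν μ α β`, letters
`c₃₅`, `p`: a reading `𝔯` whose NE2 objects at every Stage-13 datum key ARE the genuine objects `fullGCovObjects 3 F.hL b a_S ν μ α β c₃₅ p` (Bałaban's full `U ≡ 1`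
Landau-gauge pair, his site kernel `(Q′G′²Q′*)⁻¹`, his (2.156) covariance `C^{(k)}_Λ`, on the family's OWN block factor) has `S_N15 (RRec₁₃CoPH 𝔯)` — part 76
`s_N15_of_admits_fullGCov_family` at the certificate `admits_rRec₁₃CoPH_ne2`. [bookkeeping] -/
theorem s_N15_rRec₁₃CoPH_of_fullGCovReading (hb : 0 < b) (haS : 0 < aS) (ν μ α β : Fin 4) (c35 p : ℝ) (𝔯 : RateReading₁₃CoPH N)
    (h : ∀ (F : T4Family) (D : Datum F N) (hD : IsDatumOfRecord₁₃CCoPH F N D) (g₀ : ℕ → ℝ) (os : List (ULoop F)) (k : ℕ),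
      (𝔯.lit F hD.params hD.provisos g₀ os).ne2 k = haveI := neZero_blockFactor F; fullGCovObjects 3 F.hL b aS ν μ α β c35 p) :
    S_N15 (RRec₁₃CoPH 𝔯) :=
  s_N15_of_admits_fullGCov_family (N := N) (key := fun F D => IsDatumOfRecord₁₃CCoPH F N D) hb haS ν μ α β c35 p
    (fun {F D} (hD : IsDatumOfRecord₁₃CCoPH F N D) g₀ os k => (𝔯.lit F hD.params hD.provisos g₀ os).ne2 k) (RRec₁₃CoPH 𝔯) (admits_rRec₁₃CoPH_ne2 𝔯) h

/-- ★ **THE WINDOW-FREE GENUINE READING CLOSES THE STUB AT EVERY GUARDED HOME** (θ-form on the admissible tuples with provisos in `Rg`; part 76 at `(3, F.hL)` through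
74b's `s_N15_rRec₁₃CoPHOn_of_pin`). [bookkeeping] -/
theorem s_N15_rRec₁₃CoPHOn_of_fullGCovReading (hb : 0 < b) (haS : 0 < aS) (ν μ α β : Fin 4) (c35 p : ℝ) (𝔯 : RateReading₁₃CoPH N)
    (Rg : (F : T4Family) → Stage13HParams F N → Prop)
    (h : ∀ (F : T4Family) (θ : Stage13HParams F N) (hP : θ.Provisos₁₃CoPH F N), Rg F θ → θ.Admissible F N → ∀ (g₀ : ℕ → ℝ) (os : List (ULoop F)) (k : ℕ),
      (𝔯.lit F θ hP g₀ os).ne2 k = haveI := neZero_blockFactor F; fullGCovObjects 3 F.hL b aS ν μ α β c35 p) :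
    S_N15 (RRec₁₃CoPHOn 𝔯 Rg) :=
  s_N15_rRec₁₃CoPHOn_of_pin 𝔯 Rg (fun F _ _ _ _ _ => haveI := neZero_blockFactor F; fullGCovObjects 3 F.hL b aS ν μ α β c35 p) h
    fun F _ _ _ _ _ _ _ => n15At_fullGCovObjects_family hb haS ν μ α β c35 p F

/-- ★★ **SOME READING CLOSES THE STUB AT BOTH CoPH HOMES OUTRIGHT ON THE WINDOW-FREE GENUINE OBJECTS, POPULATED EVERYWHERE** [decided, non-degenerate, no weight]:
for `b, a_S > 0`, `ν μ α β`, `c₃₅`, `p` there is a Stage-13 rate reading `𝔯` whose NE2 objects at every tuple ARE `fullGCovObjects 3 F.hL b a_S ν μ α β c₃₅ p`,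
`Populated` everywhere (RR-1 §8), with `S_N15 (RRec₁₃CoPH 𝔯)` and `S_N15 (RRec₁₃CoPHOn 𝔯 Rg)` for every `Rg`, NO hypothesis and NO displayed weight — part 75's
`exists_reading_s_N15_rRec₁₃CoPH_fullG_family` with the `∃ a` GONE. [bookkeeping] -/
theorem exists_reading_s_N15_rRec₁₃CoPH_fullGCov_family (hb : 0 < b) (haS : 0 < aS) (ν μ α β : Fin 4) (c35 p : ℝ) :
    ∃ 𝔯 : RateReading₁₃CoPH N,
      (∀ (F : T4Family) (θ : Stage13HParams F N) (hP : θ.Provisos₁₃CoPH F N) (g₀ : ℕ → ℝ) (os : List (ULoop F)) (k : ℕ),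
        (𝔯.lit F θ hP g₀ os).ne2 k = haveI := neZero_blockFactor F; fullGCovObjects 3 F.hL b aS ν μ α β c35 p) ∧
      (∀ (F : T4Family) (θ : Stage13HParams F N) (hP : θ.Provisos₁₃CoPH F N) (g₀ : ℕ → ℝ) (os : List (ULoop F)) (k : ℕ),
        ((𝔯.lit F θ hP g₀ os).ne2 k).Populated) ∧
      S_N15 (RRec₁₃CoPH 𝔯) ∧ ∀ Rg : (F : T4Family) → Stage13HParams F N → Prop, S_N15 (RRec₁₃CoPHOn 𝔯 Rg) := by
  obtain ⟨r₀⟩ := Node00.nonempty_rateObjects₁₁ (N := N)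
  let lit : (F : T4Family) → (θ : Stage13HParams F N) → θ.Provisos₁₃CoPH F N → (ℕ → ℝ) → List (ULoop F) → Node00.RateObjects₁₁ N :=
    fun F _ _ _ _ => ⟨r₀.u3, r₀.ne3, fun _ => haveI := neZero_blockFactor F; fullGCovObjects 3 F.hL b aS ν μ α β c35 p⟩
  let 𝔯 : RateReading₁₃CoPH N := ⟨lit, fun _ _ _ _ _ => (⟨Empty, ⟨fun q => q.elim, fun q => q.elim, fun q => q.elim⟩, 0⟩ : NE1pCarriers)⟩
  have h𝔯 : ∀ (F : T4Family) (θ : Stage13HParams F N) (hP : θ.Provisos₁₃CoPH F N) (g₀ : ℕ → ℝ) (os : List (ULoop F)) (k : ℕ),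
      (𝔯.lit F θ hP g₀ os).ne2 k = haveI := neZero_blockFactor F; fullGCovObjects 3 F.hL b aS ν μ α β c35 p := fun _ _ _ _ _ _ => rfl
  have hS := s_N15_homes₁₃CoPH_of_forall_admissible 𝔯 fun F θ hP _ g₀ os k => by
    rw [h𝔯 F θ hP g₀ os k]
    exact n15At_fullGCovObjects_family hb haS ν μ α β c35 p F
  refine ⟨𝔯, h𝔯, fun F θ hP g₀ os k => ?_, hS.1, hS.2⟩
  rw [h𝔯 F θ hP g₀ os k]
  exact populated_fullGCovObjects_family F b aS ν μ α β c35 p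

variable (w1 : (F : T4Family) → (θ : Stage13HParams F N) → ReadingData F (Node00.MatA N) θ.τ9.M) (ℓ₃ : T4Family → NE3Letters₁₁)
  (ne2 : (F : T4Family) → Stage13HParams F N → (ℕ → ℝ) → List (ULoop F) → ℕ → NE2Objects₁₁)
  (ne1 : (F : T4Family) → Stage13HParams F N → (ℕ → ℝ) → List (ULoop F) → NE1pCarriers)

/-- ★★ **THE WINDOW-FREE GENUINE RESIDUAL LAYER CLOSES `h15` AT BOTH HOMES OF THE READING OF RECORD, NO ESTIMATE AND NO WEIGHT DISPLAYED** — the by-name swap for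
dag-n27-c's `spine_rec13CCoPH_at_readingAdm₁₃CoPH_of_fullG_family` ∕ `…CoPHOn…`: if on the admissible Stage-13 tuples with provisos N15's residual layer `ne2` takes the
genuine objects `fullGCovObjects 3 F.hL b a_S ν μ α β c₃₅ p` as values, then `S_N15` at `RRec₁₃CoPH (readingOfRecord₁₃CoPH w1 ℓ₃ ne2 ne1)` AND at every
`RRec₁₃CoPHOn (readingOfRecord₁₃CoPH w1 ℓ₃ ne2 ne1) Rg` — the three NE2 layers for Bałaban's OWN `U ≡ 1` objects on the family's L-divisible tori are theorems (part 76 §3),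
not hypotheses; plain `b, a_S > 0`, nothing else. [bookkeeping] -/
theorem s_N15_readingOfRecord₁₃CoPH_homes_of_fullGCov_family (hb : 0 < b) (haS : 0 < aS) (ν μ α β : Fin 4) (c35 p : ℝ)
    (h : ∀ (F : T4Family) (θ : Stage13HParams F N), θ.Provisos₁₃CoPH F N → θ.Admissible F N → ∀ (g₀ : ℕ → ℝ) (os : List (ULoop F)) (k : ℕ),
      ne2 F θ g₀ os k = haveI := neZero_blockFactor F; fullGCovObjects 3 F.hL b aS ν μ α β c35 p) :
    S_N15 (RRec₁₃CoPH (readingOfRecord₁₃CoPH w1 ℓ₃ ne2 ne1)) ∧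
      ∀ Rg : (F : T4Family) → Stage13HParams F N → Prop, S_N15 (RRec₁₃CoPHOn (readingOfRecord₁₃CoPH w1 ℓ₃ ne2 ne1) Rg) :=
  s_N15_readingOfRecord₁₃CoPH_homes_of_forall w1 ℓ₃ ne2 ne1 fun F θ hP hA g₀ os k => by
    rw [h F θ hP hA g₀ os k]
    exact n15At_fullGCovObjects_family hb haS ν μ α β c35 p F

/-- … at the canonical home alone (n27-c XLᶜᵒᵖᴴ ∕ leaf B §5 currency). [bookkeeping] -/
theorem s_N15_readingOfRecord₁₃CoPH_of_fullGCov_family (hb : 0 < b) (haS : 0 < aS) (ν μ α β : Fin 4) (c35 p : ℝ)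
    (h : ∀ (F : T4Family) (θ : Stage13HParams F N), θ.Provisos₁₃CoPH F N → θ.Admissible F N → ∀ (g₀ : ℕ → ℝ) (os : List (ULoop F)) (k : ℕ),
      ne2 F θ g₀ os k = haveI := neZero_blockFactor F; fullGCovObjects 3 F.hL b aS ν μ α β c35 p) :
    S_N15 (RRec₁₃CoPH (readingOfRecord₁₃CoPH w1 ℓ₃ ne2 ne1)) :=
  (s_N15_readingOfRecord₁₃CoPH_homes_of_fullGCov_family w1 ℓ₃ ne2 ne1 hb haS ν μ α β c35 p h).1

/-- … at the `Rg`-guarded home (n27-c XLI∕XLIIᶜᵒᵖᴴ ∕ leaf B §7 currency; every `Rg` at once). [bookkeeping] -/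
theorem s_N15_readingOfRecord₁₃CoPHOn_of_fullGCov_family (hb : 0 < b) (haS : 0 < aS) (ν μ α β : Fin 4) (c35 p : ℝ)
    (h : ∀ (F : T4Family) (θ : Stage13HParams F N), θ.Provisos₁₃CoPH F N → θ.Admissible F N → ∀ (g₀ : ℕ → ℝ) (os : List (ULoop F)) (k : ℕ),
      ne2 F θ g₀ os k = haveI := neZero_blockFactor F; fullGCovObjects 3 F.hL b aS ν μ α β c35 p)
    (Rg : (F : T4Family) → Stage13HParams F N → Prop) : S_N15 (RRec₁₃CoPHOn (readingOfRecord₁₃CoPH w1 ℓ₃ ne2 ne1) Rg) :=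
  (s_N15_readingOfRecord₁₃CoPH_homes_of_fullGCov_family w1 ℓ₃ ne2 ne1 hb haS ν μ α β c35 p h).2 Rg

/-- … such a reading of record is `Populated` at every Stage-13 tuple with provisos (part 76 `populated_fullGCovObjects_family`). [bookkeeping] -/
theorem populated_readingOfRecord₁₃CoPH_of_fullGCov_family (ν μ α β : Fin 4) (c35 p : ℝ) (F : T4Family) (θ : Stage13HParams F N)
    (hP : θ.Provisos₁₃CoPH F N) (g₀ : ℕ → ℝ) (os : List (ULoop F))
    (h : ∀ k : ℕ, ne2 F θ g₀ os k = haveI := neZero_blockFactor F; fullGCovObjects 3 F.hL b aS ν μ α β c35 p) :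
    ((readingOfRecord₁₃CoPH w1 ℓ₃ ne2 ne1).lit F θ hP g₀ os).Populated := by
  refine (readingOfRecord₁₃CoPH_populated_iff w1 ℓ₃ ne2 ne1 F θ hP g₀ os).2 fun k => ?_
  rw [h k]
  exact populated_fullGCovObjects_family F b aS ν μ α β c35 p

/-- ★★ **SOME RESIDUAL LAYER — THE WINDOW-FREE GENUINE ONE — CLOSES `h15` AT BOTH HOMES OF THE READING OF RECORD FOR EVERY `w1`, `ℓ₃`, `ne1`, POPULATED EVERYWHERE**
[decided, non-degenerate, GENUINE objects, no weight]: for `b, a_S > 0`, `ν μ α β`, `c₃₅`, `p` the residual layer `ne2 := fullGCovObjects 3 F.hL b a_S ν μ α β c₃₅ p`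
(constant along `(θ, g₀, os, k)`) makes the reading of record `Populated` at every Stage-13 tuple with provisos and gives `S_N15` at `RRec₁₃CoPH (readingOfRecord₁₃CoPH w1 ℓ₃
ne2 ne1)` and at every `RRec₁₃CoPHOn (…) Rg`, with NO hypothesis.  Reading for the K3⁷ composer: the N15 slot is inhabited by Bałaban's own `U ≡ 1` objects on all three
layers with no window; the objects OF RECORD (background LIVE, Node 00's [B9] operator layer) remain residual. [bookkeeping] -/
theorem exists_ne2_s_N15_readingOfRecord₁₃CoPH_fullGCov (hb : 0 < b) (haS : 0 < aS) (ν μ α β : Fin 4) (c35 p : ℝ) :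
    ∃ ne2 : (F : T4Family) → Stage13HParams F N → (ℕ → ℝ) → List (ULoop F) → ℕ → NE2Objects₁₁,
      (∀ (F : T4Family) (θ : Stage13HParams F N) (hP : θ.Provisos₁₃CoPH F N) (g₀ : ℕ → ℝ) (os : List (ULoop F)),
        ((readingOfRecord₁₃CoPH w1 ℓ₃ ne2 ne1).lit F θ hP g₀ os).Populated) ∧
      S_N15 (RRec₁₃CoPH (readingOfRecord₁₃CoPH w1 ℓ₃ ne2 ne1)) ∧
      ∀ Rg : (F : T4Family) → Stage13HParams F N → Prop, S_N15 (RRec₁₃CoPHOn (readingOfRecord₁₃CoPH w1 ℓ₃ ne2 ne1) Rg) := by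
  refine ⟨fun F _ _ _ _ => haveI := neZero_blockFactor F; fullGCovObjects 3 F.hL b aS ν μ α β c35 p, fun F θ hP g₀ os => ?_,
    s_N15_readingOfRecord₁₃CoPH_homes_of_forall w1 ℓ₃ _ ne1 fun F θ _ _ g₀ os k => n15At_fullGCovObjects_family hb haS ν μ α β c35 p F⟩
  exact populated_readingOfRecord₁₃CoPH_of_fullGCov_family (b := b) (aS := aS) w1 ℓ₃ _ ne1 ν μ α β c35 p F θ hP g₀ os fun _ => rfl

end Genuine

end Summit.QuantumFields.YangMills.BalabanUVNodes.N15.AtReadingOfRecord13CoPH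

end
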